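import Literature.Analysis.FluidPDE.LeiZhang2017SmallSwirlContinuation
import Literature.Analysis.FluidPDE.Wei2016SwirlCriterionProofs
import HarnessLib

/-!
# Wei 2016, Cor. 1.1: the continuation end-game (reduction to the a-priori enstrophy bound)

Analysis/FluidPDE proof file (all results proved, no definitions, no named facts) on the way to
`Literature.Analysis.FluidPDE.Wei2016_logModulus_regularity`
(`LeiZhang2017AxisymmetricCriteria.lean`), after

* D. Wei, *Regularity criterion to the axially symmetric Navier–Stokes equations*, J. Math.
  Anal. Appl. 435 (2016) 402–413 = arXiv:1508.03318, Cor. 1.1 and §1, p. 4: "Throughout this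
  paper, we assume `u ∈ C([0,T*); H²)` to be the unique strong solution … Due to the regularity
  of solutions to Navier–Stokes equations, `u ∈ C((0,T*); H⁴)` … Hence, all calculations below
  are legal"; "Here global regularity means `T* = +∞`, and we only need to prove
  `Ω ∈ L^∞(0, T*; L²(ℝ³))`".

The printed proof is an **a-priori estimate for the strong solution** followed by the standard
continuation argument. This file formalises exactly that end-game in the tree's vocabulary —
the same reduction as the tree's `LeiZhang2017_smallSwirl_regularity_of_enstrophy_apriori`
(`LeiZhang2017SmallSwirlContinuation.lean`) for the neighbouring criterion of Lei–Zhang —,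
reducing the named fact to its analytic heart, an a-priori `H¹` bound in Tao's smooth class
`IsTaoSolutionOn` (`TaoClassGlue.lean`) for solutions obeying the log-modulus hypothesis (1.6),
with that bound as an explicit hypothesis (no named fact is introduced):

* `Wei2016.enstrophy_le_of_apriori` — under the a-priori hypothesis, the given classical
  Leray–Hopf solution `u` on `[0, T)` has `∫ ‖Du(t)‖² ≤ K` for all `t < T`: for `t < T' < T`
  every Tao-class solution on a sub-slab of `[0, T']` from `u(0)` coincides with `u` there
  (Prodi–Serrin weak–strong uniqueness, `eq_restart_of_serrin serrin_weak_strong_uniqueness_holds`),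
  hence inherits (1.6) and obeys the bound; the standard continuation method
  (`exists_isTaoSolutionOn_of_enstrophy_apriori`) then produces a Tao-class solution on `[0, T']`,
  equal to `u` at `t`;
* `Wei2016_logModulus_regularity_of_enstrophy_apriori` — **Cor. 1.1 from its a-priori bound**:
  the enstrophy bound on `[0, T)` feeds the tree's `H¹` continuation criterion
  `hasSmoothExtensionPast_one_of_iteratedFDeriv_one_le` (`Wei2016SwirlCriterionProofs.lean`).

What remains for `Wei2016_logModulus_regularity_holds` is the a-priori bound itself (Wei's
Lemmas 2.1–2.3 — in the tree: `Wei2016HardyLemma`, `Wei2016HardyCutoff`, `Wei2016Lemma23`,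
`Wei2016SupLemma` — and §3 (3.1)–(3.7) with the bookkeeping `Wei2016Bookkeeping`,
`Wei2016SwirlCriterionProofs`), to be proved in sibling files for Tao-class solutions.

## References

* D. Wei, arXiv:1508.03318, Cor. 1.1; §1 p. 4 (strong-solution framework, "we only need to prove
  `Ω ∈ L^∞(0,T*;L²)`"). [Wei2016]
* Z. Lei, Q. S. Zhang, Pacific J. Math. 289 (2017), §4 p. 10 ("standard continuation method";
  tree: `exists_isTaoSolutionOn_of_enstrophy_apriori`). [LeiZhang2017]
* T. Tao, Anal. PDE 6 (2013) = arXiv:1108.1165, Thm. 5.4 (local theory in the smooth class).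
  [Tao2011]
-/

noncomputable section

open MeasureTheory Set Function Filter Topology
open scoped ENNReal NNReal ContDiff

namespace Literature.Analysis.FluidPDE

namespace Wei2016

/-- **The enstrophy of the given solution is bounded under the a-priori hypothesis.** Let
`(u, p)` be a classical Leray–Hopf solution on `[0, T)` from a rapidly decaying datum, with
axisymmetric slices, `Γ₀ ∈ L^∞` and the log-modulus bound (1.6) on `[0, T)`. Assume the
a-priori bound `hA` in Tao's class for the datum `u 0` up to time `T`: every Tao-class solution
from `u 0` on `[0, T'] ⊆ [0, T]` with axisymmetric slices obeying (1.6) on `[0, T')` has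
`∫ ‖Dv(t)‖² ≤ K` on `[0, T']`. Then `∫ ‖Du(t)‖² ≤ K` for every `t ∈ [0, T)`. Proof: for
`t < T' < T`, Tao-class solutions on sub-slabs `[0, T''] ⊆ [0, T']` from `u 0` are axisymmetric
(`IsTaoSolutionOn.isAxisymmetric`) and coincide with `u` on `[0, T'')` (Prodi–Serrin weak–strong
uniqueness, `eq_restart_of_serrin serrin_weak_strong_uniqueness_holds`), so they inherit (1.6)
and obey the bound; the standard continuation method
(`exists_isTaoSolutionOn_of_enstrophy_apriori`) gives a Tao-class solution on `[0, T']`, which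
equals `u` at `t` and has enstrophy `≤ K` there. [cite: Wei2016, §1 p. 4 (the strong-solution framework) and §3] -/
theorem enstrophy_le_of_apriori {T K : ℝ}
    {u : ℝ → EuclideanSpace ℝ (Fin 3) → EuclideanSpace ℝ (Fin 3)}
    {p : ℝ → EuclideanSpace ℝ (Fin 3) → ℝ} {δ₀ : ℝ} (hT : 0 < T)
    (hcl : IsClassicalNSSolutionOn (Ico 0 T) 1 0 u p) (hLH : IsLerayHopfOn T 1 0 (u 0) u)
    (hdec : HasRapidSpatialDecay (u 0)) (haxi : ∀ t ∈ Ico 0 T, IsAxisymmetric (u t))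
    (hmod : ∀ t ∈ Ico 0 T, ∀ x : EuclideanSpace ℝ (Fin 3), 0 < cylRadius x → cylRadius x ≤ δ₀ →
      |swirl (u t) x| ≤ |Real.log (cylRadius x)| ^ (-(3 / 2 : ℝ)))
    (hK : 0 ≤ K)
    (hA : ∀ ⦃T' : ℝ⦄, 0 < T' → T' ≤ T →
      ∀ ⦃v : ℝ → EuclideanSpace ℝ (Fin 3) → EuclideanSpace ℝ (Fin 3)⦄
        ⦃q : ℝ → EuclideanSpace ℝ (Fin 3) → ℝ⦄,
        IsTaoSolutionOn T' 1 (u 0) v q →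
        (∀ t ∈ Icc 0 T', IsAxisymmetric (v t)) →
        (∀ t ∈ Ico 0 T', ∀ x : EuclideanSpace ℝ (Fin 3), 0 < cylRadius x → cylRadius x ≤ δ₀ →
            |swirl (v t) x| ≤ |Real.log (cylRadius x)| ^ (-(3 / 2 : ℝ))) →
        ∀ t ∈ Icc 0 T', ∫⁻ x, ‖iteratedFDeriv ℝ 1 (v t) x‖ₑ ^ 2 ≤ ENNReal.ofReal K) :
    ∀ t ∈ Ico 0 T, ∫⁻ x, ‖iteratedFDeriv ℝ 1 (u t) x‖ₑ ^ 2 ≤ ENNReal.ofReal K := by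
  intro t ht
  -- the datum
  have h0T : (0 : ℝ) ∈ Ico 0 T := ⟨le_rfl, hT⟩
  have hsm : ContDiff ℝ ∞ (u 0) := hcl.contDiff_velocity h0T
  have hdiv : VectorCalculus.IsDivFree (u 0) := hcl.divFree 0 h0T
  have hH : ∀ n : ℕ, ∫⁻ x, ‖iteratedFDeriv ℝ n (u 0) x‖ₑ ^ 2 < ⊤ :=
    hdec.lintegral_enorm_iteratedFDeriv_sq_lt_top
  have haxi0 : IsAxisymmetric (u 0) := haxi 0 h0T
  have hLH' : IsLerayHopfOn (T - 0) 1 0 (u 0) (fun s => u (s + 0)) := by simpa using hLH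
  -- an intermediate time `t < T' < T`
  set T' : ℝ := (t + T) / 2 with hT'def
  have htT' : t < T' := by rw [hT'def]; linarith [ht.2]
  have hT'T : T' < T := by rw [hT'def]; linarith [ht.2]
  have hT'pos : 0 < T' := ht.1.trans_lt htT'
  -- identification of Tao-class solutions on `[0, T''] ⊆ [0, T']` with `u` on `[0, T'')`
  have hident : ∀ ⦃T'' : ℝ⦄, 0 < T'' → T'' ≤ T' →
      ∀ ⦃v : ℝ → EuclideanSpace ℝ (Fin 3) → EuclideanSpace ℝ (Fin 3)⦄
        ⦃q : ℝ → EuclideanSpace ℝ (Fin 3) → ℝ⦄,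
        IsTaoSolutionOn T'' 1 (u 0) v q → ∀ s ∈ Ico 0 T'', u s = v s := by
    intro T'' hT'' hT''T' v q hv s hs
    have heq := eq_restart_of_serrin serrin_weak_strong_uniqueness_holds one_pos hT'' le_rfl hT
      hcl hLH' hv.classical hv.initial hv.sobolev hv.sobolev_p hv.continuousL2
    have hs' : s ∈ Ico 0 (min T'' (T - 0)) :=
      ⟨hs.1, lt_min hs.2 (by linarith [hs.2, hT''T', hT'T])⟩
    simpa using heq s hs'
  -- the a-priori bound for all Tao-class solutions on sub-slabs of `[0, T']`
  have hbound : ∀ ⦃T'' : ℝ⦄, 0 < T'' → T'' ≤ T' →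
      ∀ ⦃v : ℝ → EuclideanSpace ℝ (Fin 3) → EuclideanSpace ℝ (Fin 3)⦄
        ⦃q : ℝ → EuclideanSpace ℝ (Fin 3) → ℝ⦄,
        IsTaoSolutionOn T'' 1 (u 0) v q →
        ∀ s ∈ Icc 0 T'', ∫⁻ x, ‖iteratedFDeriv ℝ 1 (v s) x‖ₑ ^ 2 ≤ ENNReal.ofReal K := by
    intro T'' hT'' hT''T' v q hv
    have haxv : ∀ s ∈ Icc 0 T'', IsAxisymmetric (v s) := hv.isAxisymmetric one_pos hT'' haxi0
    have hmodv : ∀ s ∈ Ico 0 T'', ∀ x : EuclideanSpace ℝ (Fin 3), 0 < cylRadius x →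
        cylRadius x ≤ δ₀ → |swirl (v s) x| ≤ |Real.log (cylRadius x)| ^ (-(3 / 2 : ℝ)) := by
      intro s hs x hx hxδ
      rw [← hident hT'' hT''T' hv s hs]
      exact hmod s ⟨hs.1, by linarith [hs.2, hT''T', hT'T]⟩ x hx hxδ
    exact hA hT'' (by linarith [hT''T', hT'T]) hv haxv hmodv
  -- a Tao-class solution on `[0, T']`, equal to `u` at `t`
  obtain ⟨v, q, hv⟩ :=
    exists_isTaoSolutionOn_of_enstrophy_apriori one_pos hsm hdiv hH hT'pos hK hbound
  rw [hident hT'pos le_rfl hv t ⟨ht.1, htT'⟩]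
  exact hbound hT'pos le_rfl hv t ⟨ht.1, htT'.le⟩

end Wei2016

/-- **Wei 2016, Cor. 1.1 from its a-priori enstrophy bound.** Hypothesis `hA` (the analytic
content of the printed proof, §3, rendered in Tao's smooth class): for `δ₀ ∈ (0, 1/2)`, `T > 0`
and every smooth, divergence-free, rapidly decaying, axisymmetric datum `u₀` with `Γ₀ ∈ L^∞`,
there is `K ≥ 0` bounding `∫ ‖Dv(t)‖²` on `[0, T']` for every Tao-class solution `v` from `u₀`
on `[0, T'] ⊆ [0, T]` with axisymmetric slices obeying the log-modulus bound (1.6) on `[0, T')`.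
Conclusion: the named fact `Wei2016_logModulus_regularity`. Proof ("we only need to prove
`Ω ∈ L^∞(0,T*;L²)`", i.e. an `H¹` bound, in the strong-solution framework of §1 p. 4): the datum
`u 0` of the given classical Leray–Hopf solution is smooth, divergence free, in `H^∞` (rapid
decay) and axisymmetric, so `Wei2016.enstrophy_le_of_apriori` bounds `∫ ‖Du(t)‖²` on `[0, T)`,
and the `H¹` continuation criterion `hasSmoothExtensionPast_one_of_iteratedFDeriv_one_le`
(Leray; local strong theory + weak–strong uniqueness) extends `u` smoothly past `T`. [cite: Wei2016, Cor. 1.1 and its proof (§3, p. 9), §1 p. 4] -/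
theorem Wei2016_logModulus_regularity_of_enstrophy_apriori
    (hA : ∀ ⦃δ₀ : ℝ⦄, 0 < δ₀ → δ₀ < 1 / 2 → ∀ ⦃T : ℝ⦄, 0 < T →
      ∀ ⦃u₀ : EuclideanSpace ℝ (Fin 3) → EuclideanSpace ℝ (Fin 3)⦄,
        ContDiff ℝ ∞ u₀ → VectorCalculus.IsDivFree u₀ → HasRapidSpatialDecay u₀ →
        (∀ n : ℕ, ∫⁻ x, ‖iteratedFDeriv ℝ n u₀ x‖ₑ ^ 2 < ⊤) → IsAxisymmetric u₀ →
        eLpNorm (swirl u₀) ⊤ volume < ⊤ →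
        ∃ K : ℝ, 0 ≤ K ∧ ∀ ⦃T' : ℝ⦄, 0 < T' → T' ≤ T →
          ∀ ⦃v : ℝ → EuclideanSpace ℝ (Fin 3) → EuclideanSpace ℝ (Fin 3)⦄
            ⦃q : ℝ → EuclideanSpace ℝ (Fin 3) → ℝ⦄,
            IsTaoSolutionOn T' 1 u₀ v q →
            (∀ t ∈ Icc 0 T', IsAxisymmetric (v t)) →
            (∀ t ∈ Ico 0 T', ∀ x : EuclideanSpace ℝ (Fin 3), 0 < cylRadius x →
                cylRadius x ≤ δ₀ → |swirl (v t) x| ≤ |Real.log (cylRadius x)| ^ (-(3 / 2 : ℝ))) →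
            ∀ t ∈ Icc 0 T', ∫⁻ x, ‖iteratedFDeriv ℝ 1 (v t) x‖ₑ ^ 2 ≤ ENNReal.ofReal K) :
    Wei2016_logModulus_regularity := by
  intro δ₀ hδ₀ hδ T u p hT hcl hLH hdec haxi hΓ hmod
  have h0T : (0 : ℝ) ∈ Ico 0 T := ⟨le_rfl, hT⟩
  obtain ⟨K, hK, hA'⟩ := hA hδ₀ hδ hT (hcl.contDiff_velocity h0T) (hcl.divFree 0 h0T) hdec
    hdec.lintegral_enorm_iteratedFDeriv_sq_lt_top (haxi 0 h0T) hΓ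
  exact hasSmoothExtensionPast_one_of_iteratedFDeriv_one_le hT hcl hLH
    (Wei2016.enstrophy_le_of_apriori hT hcl hLH hdec haxi hmod hK hA')

end Literature.Analysis.FluidPDE

end
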